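import Summits.KontsevichZagierPeriods.Zeta5Search.Certificates.RecordRayDenominatorsWindows
import HarnessLib

/-!
# ζ(5) search — the record ray's DENOMINATORS, IV: the window multiplier and the hypothesis-free exponent `0.4949` (TYPER g15)

HONEST FRAMING: systematic search; no irrationality claim unless certified.

OUR work (Summit side; typer seat, generation 15).  Assembly of `RecordRayDenominators{,Size,Windows}`:

* `dvd_wedge_term`, `dvd_q_term` — for a prime `16n < p ≤ 41n`, `p^{k(p)}` divides each product
  `(d³N♯W)(d⁶N♯V)` and `d⁵(dN♯U)(d³N♯W)` of the multiplied wedge / Q-minor, with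
  `k = 8, 9, 10, 9` on `(16n,17n], (17n,18n], (18n,25n], (25n,41n]` (`kfun`; per-prime valuations of file III);
* `corr n = Φ_n = ∏_i (∏_{A_i n < p ≤ B_i n} p)^{w_i}` (`Literature…Hata1992.multiWindowProd`, windows `Awin/Bwin/wwin`),
  `M n = M0 n / Φ_n`; `M_mul_recordP_int`, `M_mul_recordQ_int` (`multiWindowProd_dvd_int`), `M_pos`;
* `eventually_M_le_exp` — `M n ≤ e^{(150.5232+ε)n}` (prime number theorem: `Φ_n ≥ e^{(231−ε)n}`, `window_rate`);
* `record_exponent_windows` — **hypothesis-free: for every `0 ≤ γ ≤ 0.4949`, eventually `|ζ(5) − P_n/Q(a·n)| < 1/q_n^γ`**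
  with the integers `p_n = M n·P_n`, `q_n = M n·|Q(a·n)|` (Brown–Zudilin print `0.86` from the OBSERVED denominators
  (28)–(30); the census engine's by-prime column of landed laws gives `0.855`; each further certified window `(A, B, k)`
  added to `Awin/Bwin/wwin` with its per-prime lemma raises the kernel value).  No irrationality content (`γ < 1`).
-/

noncomputable section

open Finset Real Filter Topology

namespace Summit.KontsevichZagierPeriods.Zeta5Search.RecordRay

open Summit.KontsevichZagierPeriods.Zeta5Search.DualSeries
open Summit.KontsevichZagierPeriods.Zeta5Search.DualSeriesDenominators
open Summit.KontsevichZagierPeriods.Zeta5Search.WedgeDictionary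
open Summit.KontsevichZagierPeriods.Zeta5Search.DualSeriesLemma19 (bRecord)
open Literature.NumberTheory.Irrationality.Hata1992
open Literature.NumberTheory.Transcendental (zetaValue)

section Prime2

variable {n p : ℕ}

/-- The window exponent: `8` on `(16n,17n]`, `9` on `(17n,18n]`, `10` on `(18n,25n]`, `9` on `(25n,41n]`. -/
def kfun (n p : ℕ) : ℕ := if p ≤ 17 * n then 8 else if p ≤ 18 * n then 9 else if p ≤ 25 * n then 10 else 9

/-- The exponent arithmetic: `kfun + N_p-bound ≤ 9 + [p ≤ 25n]`. -/
theorem kfun_le (n p : ℕ) :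
    (kfun n p : ℤ) + pfBound n p ≤ 9 + (if p ≤ 25 * n then (1 : ℤ) else 0) := by
  unfold kfun pfBound
  split_ifs <;> push_cast <;> omega

/-- **Divisibility of one wedge product** `(d³N♯(b₁)W(b₁))·(d⁶N♯(b₂)V(b₂))` by `p^{kfun}`, for `{b₁, b₂} = {b, b′}`. -/
theorem dvd_wedge_term (hn : 1 ≤ n) (hp : p.Prime) (hlo : 16 * n + 1 ≤ p) (hhi : p ≤ 41 * n)
    {b₁ b₂ : ℕ → ℤ} (hb₁ : b₁ = bRecord n ∨ b₁ = bRecord' n) (hb₂ : b₂ = bRecord n ∨ b₂ = bRecord' n)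
    {zW zV : ℤ} (hzW : dRec n ^ 3 * sharpNormaliser b₁ * coeffW b₁ = zW)
    (hzV : dRec n ^ 6 * sharpNormaliser b₂ * coeffV b₂ = zV) : (p : ℤ) ^ kfun n p ∣ zW * zV := by
  haveI := Fact.mk hp
  by_cases h0 : zW * zV = 0
  · rw [h0]; exact dvd_zero _
  have hzW0 : zW ≠ 0 := left_ne_zero_of_mul h0
  have hzV0 : zV ≠ 0 := right_ne_zero_of_mul h0
  have hd : dRec n ≠ 0 := (dRec_pos n).ne'
  have hN₁ : sharpNormaliser b₁ ≠ 0 := (sharpNormaliser_pos _).ne'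
  have hN₂ : sharpNormaliser b₂ ≠ 0 := (sharpNormaliser_pos _).ne'
  have hW : coeffW b₁ ≠ 0 := by
    intro h; apply hzW0; have := hzW; rw [h, mul_zero] at this; exact_mod_cast this.symm
  have hV : coeffV b₂ ≠ 0 := by
    intro h; apply hzV0; have := hzV; rw [h, mul_zero] at this; exact_mod_cast this.symm
  -- bounds at b₁ and b₂
  have h21 : bn b₁ 2 = 16 * n ∧ bn b₁ 3 = 15 * n := by
    rcases hb₁ with rfl | rfl
    · exact ⟨bn_bRecord_slot n (by norm_num) (by norm_num), bn_bRecord_slot n (by norm_num) (by norm_num)⟩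
    · exact ⟨bn_bRecord'_slot n (by norm_num) (by norm_num), bn_bRecord'_slot n (by norm_num) (by norm_num)⟩
  have h22 : bn b₂ 2 = 16 * n ∧ bn b₂ 3 = 15 * n := by
    rcases hb₂ with rfl | rfl
    · exact ⟨bn_bRecord_slot n (by norm_num) (by norm_num), bn_bRecord_slot n (by norm_num) (by norm_num)⟩
    · exact ⟨bn_bRecord'_slot n (by norm_num) (by norm_num), bn_bRecord'_slot n (by norm_num) (by norm_num)⟩
  have hWv : (if p ≤ 25 * n then (1 : ℤ) else 0) ≤ padicValRat p (coeffW b₁) := by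
    rcases hb₁ with rfl | rfl
    · exact (coeff_bounds_bRecord hn hp hlo hhi).1 hW
    · exact (coeff_bounds_bRecord' hn hp hlo hhi).1 hW
  have hVv : -pfBound n p ≤ padicValRat p (coeffV b₂) := by
    rcases hb₂ with rfl | rfl
    · exact (coeff_bounds_bRecord hn hp hlo hhi).2.2 hV
    · exact (coeff_bounds_bRecord' hn hp hlo hhi).2.2 hV
  have hN₁v := padicValRat_sharpNormaliser_nonneg hp hlo h21.1 h21.2
  have hN₂v := padicValRat_sharpNormaliser_nonneg hp hlo h22.1 h22.2
  have hdv := padicValRat_dRec hn hp hlo hhi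
  -- valuation of the product
  rw [padicValInt_dvd_iff]
  right
  have hval : ((padicValInt p (zW * zV) : ℕ) : ℤ) = padicValRat p (dRec n ^ 3 * sharpNormaliser b₁ * coeffW b₁) +
      padicValRat p (dRec n ^ 6 * sharpNormaliser b₂ * coeffV b₂) := by
    rw [← padicValRat.of_int, Int.cast_mul, ← hzW, ← hzV]
    exact padicValRat.mul (by rw [hzW]; exact_mod_cast hzW0) (by rw [hzV]; exact_mod_cast hzV0)
  rw [padicValRat.mul (mul_ne_zero (pow_ne_zero _ hd) hN₁) hW, padicValRat.mul (pow_ne_zero _ hd) hN₁,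
    padicValRat.mul (mul_ne_zero (pow_ne_zero _ hd) hN₂) hV, padicValRat.mul (pow_ne_zero _ hd) hN₂,
    padicValRat.pow, padicValRat.pow, hdv] at hval
  have hk := kfun_le n p
  have : (kfun n p : ℤ) ≤ ((padicValInt p (zW * zV) : ℕ) : ℤ) := by rw [hval]; push_cast; linarith
  exact_mod_cast this

/-- **Divisibility of one Q-side product** `d⁵·(dN♯(b₁)U(b₁))·(d³N♯(b₂)W(b₂))` by `p^{kfun}`. -/
theorem dvd_q_term (hn : 1 ≤ n) (hp : p.Prime) (hlo : 16 * n + 1 ≤ p) (hhi : p ≤ 41 * n)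
    {b₁ b₂ : ℕ → ℤ} (hb₁ : b₁ = bRecord n ∨ b₁ = bRecord' n) (hb₂ : b₂ = bRecord n ∨ b₂ = bRecord' n)
    {zU zW : ℤ} (hzU : dRec n * sharpNormaliser b₁ * coeffU b₁ = zU)
    (hzW : dRec n ^ 3 * sharpNormaliser b₂ * coeffW b₂ = zW) :
    (p : ℤ) ^ kfun n p ∣ (Nat.lcmUpto (41 * n) : ℤ) ^ 5 * (zU * zW) := by
  haveI := Fact.mk hp
  by_cases h0 : zU * zW = 0
  · rw [h0, mul_zero]; exact dvd_zero _
  have hzU0 : zU ≠ 0 := left_ne_zero_of_mul h0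
  have hzW0 : zW ≠ 0 := right_ne_zero_of_mul h0
  have hd : dRec n ≠ 0 := (dRec_pos n).ne'
  have hN₁ : sharpNormaliser b₁ ≠ 0 := (sharpNormaliser_pos _).ne'
  have hN₂ : sharpNormaliser b₂ ≠ 0 := (sharpNormaliser_pos _).ne'
  have hU : coeffU b₁ ≠ 0 := by
    intro h; apply hzU0; have := hzU; rw [h, mul_zero] at this; exact_mod_cast this.symm
  have hW : coeffW b₂ ≠ 0 := by
    intro h; apply hzW0; have := hzW; rw [h, mul_zero] at this; exact_mod_cast this.symm
  have h21 : bn b₁ 2 = 16 * n ∧ bn b₁ 3 = 15 * n := by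
    rcases hb₁ with rfl | rfl
    · exact ⟨bn_bRecord_slot n (by norm_num) (by norm_num), bn_bRecord_slot n (by norm_num) (by norm_num)⟩
    · exact ⟨bn_bRecord'_slot n (by norm_num) (by norm_num), bn_bRecord'_slot n (by norm_num) (by norm_num)⟩
  have h22 : bn b₂ 2 = 16 * n ∧ bn b₂ 3 = 15 * n := by
    rcases hb₂ with rfl | rfl
    · exact ⟨bn_bRecord_slot n (by norm_num) (by norm_num), bn_bRecord_slot n (by norm_num) (by norm_num)⟩
    · exact ⟨bn_bRecord'_slot n (by norm_num) (by norm_num), bn_bRecord'_slot n (by norm_num) (by norm_num)⟩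
  have hUv : 0 ≤ padicValRat p (coeffU b₁) := by
    rcases hb₁ with rfl | rfl
    · exact (coeff_bounds_bRecord hn hp hlo hhi).2.1 hU
    · exact (coeff_bounds_bRecord' hn hp hlo hhi).2.1 hU
  have hWv : (if p ≤ 25 * n then (1 : ℤ) else 0) ≤ padicValRat p (coeffW b₂) := by
    rcases hb₂ with rfl | rfl
    · exact (coeff_bounds_bRecord hn hp hlo hhi).1 hW
    · exact (coeff_bounds_bRecord' hn hp hlo hhi).1 hW
  have hN₁v := padicValRat_sharpNormaliser_nonneg hp hlo h21.1 h21.2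
  have hN₂v := padicValRat_sharpNormaliser_nonneg hp hlo h22.1 h22.2
  have hdv := padicValRat_dRec hn hp hlo hhi
  have hD : ((Nat.lcmUpto (41 * n) : ℤ) : ℚ) = dRec n := by unfold dRec; push_cast; rfl
  have hD0 : (Nat.lcmUpto (41 * n) : ℤ) ≠ 0 := by exact_mod_cast (Nat.lcmUpto_pos _).ne'
  rw [padicValInt_dvd_iff]
  right
  have hval : ((padicValInt p ((Nat.lcmUpto (41 * n) : ℤ) ^ 5 * (zU * zW)) : ℕ) : ℤ) =
      padicValRat p (dRec n ^ 5) + (padicValRat p (dRec n * sharpNormaliser b₁ * coeffU b₁) +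
      padicValRat p (dRec n ^ 3 * sharpNormaliser b₂ * coeffW b₂)) := by
    rw [← padicValRat.of_int, Int.cast_mul, Int.cast_pow, Int.cast_mul, hD, ← hzU, ← hzW,
      padicValRat.mul (pow_ne_zero _ hd) (mul_ne_zero (by rw [hzU]; exact_mod_cast hzU0) (by rw [hzW]; exact_mod_cast hzW0)),
      padicValRat.mul (by rw [hzU]; exact_mod_cast hzU0) (by rw [hzW]; exact_mod_cast hzW0)]
  rw [padicValRat.mul (mul_ne_zero hd hN₁) hU, padicValRat.mul hd hN₁,
    padicValRat.mul (mul_ne_zero (pow_ne_zero _ hd) hN₂) hW, padicValRat.mul (pow_ne_zero _ hd) hN₂,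
    padicValRat.pow, padicValRat.pow, hdv] at hval
  have hk := kfun_le n p
  have hpf : 0 ≤ pfBound n p := by unfold pfBound; split_ifs <;> norm_num
  have : (kfun n p : ℤ) ≤ ((padicValInt p ((Nat.lcmUpto (41 * n) : ℤ) ^ 5 * (zU * zW)) : ℕ) : ℤ) := by
    rw [hval]; push_cast; linarith
  exact_mod_cast this

end Prime2

/-! ### The window atlas `Φ_n` and the multiplier `M = M0/Φ` -/

/-- Left endpoints of the four windows: `16, 17, 18, 25` (times `n`). -/
def Awin : Fin 4 → ℝ := ![16, 17, 18, 25]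

/-- Right endpoints of the four windows: `17, 18, 25, 41` (times `n`). -/
def Bwin : Fin 4 → ℝ := ![17, 18, 25, 41]

/-- Exponents removed on the four windows: `8, 9, 10, 9`. -/
def wwin : Fin 4 → ℕ := ![8, 9, 10, 9]

/-- The window factor `Φ_n = ∏_{16n<p≤17n} p⁸ ∏_{17n<p≤18n} p⁹ ∏_{18n<p≤25n} p¹⁰ ∏_{25n<p≤41n} p⁹`. -/
def corr (n : ℕ) : ℕ := multiWindowProd Finset.univ Awin Bwin wwin n

/-- **The multiplier** `M n = M0 n / Φ_n`. -/
def M (n : ℕ) : ℚ := M0 n / (corr n : ℚ)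

/-- `Φ_n > 0`. -/
theorem corr_pos (n : ℕ) : 0 < corr n := multiWindowProd_pos _ _ _ _ _

/-- `0 < M n`. -/
theorem M_pos (n : ℕ) : 0 < M n := div_pos (M0_pos n) (by exact_mod_cast corr_pos n)

/-- The windows are genuine intervals: `0 ≤ A_i ≤ B_i`. -/
theorem Awin_le_Bwin : ∀ i ∈ (Finset.univ : Finset (Fin 4)), 0 ≤ Awin i ∧ Awin i ≤ Bwin i := by
  intro i _
  fin_cases i <;> simp [Awin, Bwin] <;> norm_num

/-- `Σ_i w_i (B_i − A_i) = 8 + 9 + 70 + 144 = 231`. -/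
theorem window_rate : ∑ i ∈ (Finset.univ : Finset (Fin 4)), (wwin i : ℝ) * (Bwin i - Awin i) = 231 := by
  simp [Fin.sum_univ_four, Awin, Bwin, wwin]
  norm_num

/-- A prime of window `i` lies in `(16n, 41n]` and its exponent `w_i` is `kfun n p`. -/
theorem window_prime {n : ℕ} {i : Fin 4} {p : ℕ} (hp : p ∈ windowPrimes (Awin i) (Bwin i) n) :
    p.Prime ∧ 16 * n + 1 ≤ p ∧ p ≤ 41 * n ∧ wwin i = kfun n p := by
  have hA : 0 ≤ Awin i := (Awin_le_Bwin i (Finset.mem_univ _)).1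
  obtain ⟨hpr, h1, h2⟩ := (mem_windowPrimes_iff hA).1 hp
  fin_cases i <;> simp [Awin, Bwin, wwin] at h1 h2 ⊢
  · have a : 16 * n < p := by exact_mod_cast h1
    have b : p ≤ 17 * n := by exact_mod_cast h2
    exact ⟨hpr, by omega, by omega, by simp [kfun, b]⟩
  · have a : 17 * n < p := by exact_mod_cast h1
    have b : p ≤ 18 * n := by exact_mod_cast h2
    exact ⟨hpr, by omega, by omega, by simp [kfun, b, show ¬ p ≤ 17 * n by omega]⟩
  · have a : 18 * n < p := by exact_mod_cast h1
    have b : p ≤ 25 * n := by exact_mod_cast h2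
    exact ⟨hpr, by omega, by omega, by simp [kfun, b, show ¬ p ≤ 17 * n by omega, show ¬ p ≤ 18 * n by omega]⟩
  · have a : 25 * n < p := by exact_mod_cast h1
    have b : p ≤ 41 * n := by exact_mod_cast h2
    exact ⟨hpr, by omega, by omega, by
      simp [kfun, show ¬ p ≤ 17 * n by omega, show ¬ p ≤ 18 * n by omega, show ¬ p ≤ 25 * n by omega]⟩

/-- The four windows are pairwise disjoint. -/
theorem windows_disjoint (n : ℕ) : ∀ i ∈ (Finset.univ : Finset (Fin 4)), ∀ j ∈ (Finset.univ : Finset (Fin 4)), i ≠ j →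
    Disjoint (windowPrimes (Awin i) (Bwin i) n) (windowPrimes (Awin j) (Bwin j) n) := by
  intro i _ j _ hij
  rw [Finset.disjoint_left]
  intro p hpi hpj
  obtain ⟨-, a1, b1⟩ := (mem_windowPrimes_iff (Awin_le_Bwin i (Finset.mem_univ _)).1).1 hpi
  obtain ⟨-, a2, b2⟩ := (mem_windowPrimes_iff (Awin_le_Bwin j (Finset.mem_univ _)).1).1 hpj
  fin_cases i <;> fin_cases j <;> simp [Awin, Bwin] at a1 b1 a2 b2 hij <;> linarith

/-- **`M n · P_n ∈ ℤ`** (`n ≥ 1`): `M·P = ±(z_{W′}z_V − z_W z_{V′})/Φ_n` and every prime power of `Φ_n` divides both products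
(`dvd_wedge_term`). -/
theorem M_mul_recordP_int {n : ℕ} (hn : 1 ≤ n) : ∃ z : ℤ, M n * recordP n = z := by
  classical
  obtain ⟨-, ⟨zW, hzW⟩, ⟨zV, hzV⟩, -, ⟨zW', hzW'⟩, ⟨zV', hzV'⟩⟩ := sharp_ints hn
  obtain ⟨s, -, hρ⟩ := exists_sign_mul_abs _ (rhoOf_aRec_ne_zero n)
  have habs : |rhoOf (aRec n)| ≠ 0 := abs_ne_zero.2 (rhoOf_aRec_ne_zero n)
  have hdiv : rhoOf (aRec n) / |rhoOf (aRec n)| = s := by rw [div_eq_iff habs]; exact hρ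
  have key : M0 n * recordP n = (rhoOf (aRec n) / |rhoOf (aRec n)|) *
      ((dRec n ^ 3 * sharpNormaliser (bRecord' n) * coeffW (bRecord' n)) *
      (dRec n ^ 6 * sharpNormaliser (bRecord n) * coeffV (bRecord n)) -
      (dRec n ^ 3 * sharpNormaliser (bRecord n) * coeffW (bRecord n)) *
      (dRec n ^ 6 * sharpNormaliser (bRecord' n) * coeffV (bRecord' n))) := by
    unfold M0 recordP
    field_simp
  rw [hdiv, hzW, hzV, hzW', hzV'] at key
  have hdvd : ((corr n : ℕ) : ℤ) ∣ (zW' * zV - zW * zV') := by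
    apply multiWindowProd_dvd_int
    · intro i _ p hp
      obtain ⟨hpr, hlo, hhi, hw⟩ := window_prime hp
      rw [hw]
      exact dvd_sub (dvd_wedge_term hn hpr hlo hhi (Or.inr rfl) (Or.inl rfl) hzW' hzV)
        (dvd_wedge_term hn hpr hlo hhi (Or.inl rfl) (Or.inr rfl) hzW hzV')
    · exact windows_disjoint n
  obtain ⟨q, hq⟩ := hdvd
  refine ⟨s * q, ?_⟩
  have hc : (corr n : ℚ) ≠ 0 := by exact_mod_cast (corr_pos n).ne'
  have e : (zW' : ℚ) * zV - zW * zV' = (corr n : ℚ) * q := by exact_mod_cast hq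
  calc M n * recordP n = M0 n * recordP n / corr n := by unfold M; ring
    _ = s * ((zW' : ℚ) * zV - zW * zV') / corr n := by rw [key]
    _ = ((s * q : ℤ) : ℚ) := by rw [e]; push_cast; field_simp

/-- **`M n · Q(a·n) ∈ ℤ`** (`n ≥ 1`): `M·Q = ±d⁵(z_U z_{W′} − z_{U′} z_W)/Φ_n` (`dvd_q_term`). -/
theorem M_mul_recordQ_int {n : ℕ} (hn : 1 ≤ n) : ∃ z : ℤ, M n * recordQ n = z := by
  classical
  obtain ⟨⟨zU, hzU⟩, ⟨zW, hzW⟩, -, ⟨zU', hzU'⟩, ⟨zW', hzW'⟩, -⟩ := sharp_ints hn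
  obtain ⟨s, -, hρ⟩ := exists_sign_mul_abs _ (rhoOf_aRec_ne_zero n)
  have habs : |rhoOf (aRec n)| ≠ 0 := abs_ne_zero.2 (rhoOf_aRec_ne_zero n)
  have hdiv : rhoOf (aRec n) / |rhoOf (aRec n)| = s := by rw [div_eq_iff habs]; exact hρ
  have hQ := recordQ_eq_wedge hn
  have key : M0 n * recordQ n = (rhoOf (aRec n) / |rhoOf (aRec n)|) * dRec n ^ 5 *
      ((dRec n * sharpNormaliser (bRecord n) * coeffU (bRecord n)) *
      (dRec n ^ 3 * sharpNormaliser (bRecord' n) * coeffW (bRecord' n)) -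
      (dRec n * sharpNormaliser (bRecord' n) * coeffU (bRecord' n)) *
      (dRec n ^ 3 * sharpNormaliser (bRecord n) * coeffW (bRecord n))) := by
    unfold M0
    rw [hQ]
    field_simp
  rw [hdiv, hzU, hzW, hzU', hzW'] at key
  set D : ℤ := (Nat.lcmUpto (41 * n) : ℤ) with hD
  have hdvd : ((corr n : ℕ) : ℤ) ∣ (D ^ 5 * (zU * zW') - D ^ 5 * (zU' * zW)) := by
    apply multiWindowProd_dvd_int
    · intro i _ p hp
      obtain ⟨hpr, hlo, hhi, hw⟩ := window_prime hp
      rw [hw]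
      exact dvd_sub (dvd_q_term hn hpr hlo hhi (Or.inl rfl) (Or.inr rfl) hzU hzW')
        (dvd_q_term hn hpr hlo hhi (Or.inr rfl) (Or.inl rfl) hzU' hzW)
    · exact windows_disjoint n
  obtain ⟨q, hq⟩ := hdvd
  refine ⟨s * q, ?_⟩
  have hc : (corr n : ℚ) ≠ 0 := by exact_mod_cast (corr_pos n).ne'
  have hDq : (D : ℚ) = dRec n := by rw [hD]; unfold dRec; push_cast; rfl
  have e : (dRec n) ^ 5 * ((zU : ℚ) * zW' - zU' * zW) = (corr n : ℚ) * q := by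
    rw [← hDq]; exact_mod_cast (by rw [← hq]; ring : D ^ 5 * (zU * zW' - zU' * zW) = (corr n : ℤ) * q)
  calc M n * recordQ n = M0 n * recordQ n / corr n := by unfold M; ring
    _ = s * (dRec n ^ 5 * ((zU : ℚ) * zW' - zU' * zW)) / corr n := by rw [key]; ring
    _ = ((s * q : ℤ) : ℚ) := by rw [e]; push_cast; field_simp

/-- **Size of the multiplier**: for every `ε > 0`, eventually `M n ≤ e^{(150.5232 + ε)·n}` (`381.5232 − 231`). -/
theorem eventually_M_le_exp {ε : ℝ} (hε : 0 < ε) :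
    ∀ᶠ n : ℕ in atTop, ((M n : ℚ) : ℝ) ≤ Real.exp ((1505232 / 10000 + ε) * n) := by
  have hε2 : 0 < ε / 2 := by positivity
  have hΦ := eventually_exp_le_multiWindowProd (s := (Finset.univ : Finset (Fin 4))) (w := wwin) Awin_le_Bwin hε2
  filter_upwards [eventually_M0_le_exp hε2, hΦ] with n hM0 hcorr
  rw [window_rate] at hcorr
  have hcorr' : Real.exp ((231 - ε / 2) * n) ≤ ((corr n : ℕ) : ℝ) := hcorr
  have hcpos : (0 : ℝ) < ((corr n : ℕ) : ℝ) := by exact_mod_cast corr_pos n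
  have hcast : ((M n : ℚ) : ℝ) = ((M0 n : ℚ) : ℝ) / ((corr n : ℕ) : ℝ) := by
    unfold M; push_cast; rfl
  rw [hcast]
  calc ((M0 n : ℚ) : ℝ) / ((corr n : ℕ) : ℝ) ≤ Real.exp ((3815232 / 10000 + ε / 2) * n) / ((corr n : ℕ) : ℝ) :=
        div_le_div_of_nonneg_right hM0 hcpos.le
    _ ≤ Real.exp ((3815232 / 10000 + ε / 2) * n) / Real.exp ((231 - ε / 2) * n) :=
        div_le_div_of_nonneg_left (Real.exp_pos _).le (Real.exp_pos _) hcorr'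
    _ = Real.exp ((1505232 / 10000 + ε) * n) := by rw [← Real.exp_sub]; ring_nf

/-- **THE EXPONENT `0.4949`, hypothesis-free.**  For every `0 ≤ γ ≤ 0.4949`, eventually
`|ζ(5) − P_n/Q(a·n)| < 1/q_n^γ` with the integers `p_n = M n·P_n`, `q_n = M n·|Q(a·n)| ≥ 1`.
Arithmetic: `0.4949·(150.5432 + 85.08768884) < 85.08768883 + 31.5452`.  No irrationality content (`γ < 1`). -/
theorem record_exponent_windows {γ : ℝ} (hγ0 : 0 ≤ γ) (hγ : γ ≤ 4949 / 10 ^ 4) :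
    ∀ᶠ n : ℕ in atTop, ∃ p : ℤ, ∃ q : ℕ, 1 ≤ q ∧ (q : ℚ) = M n * |(recordQ n : ℚ)| ∧ (p : ℚ) = M n * recordP n ∧
      |zetaValue 5 - (recordP n : ℝ) / (recordQ n : ℝ)| < 1 / (q : ℝ) ^ γ := by
  refine record_exponent_rat (lam := 1505232 / 10000 + 2 / 100) M ?_ hγ0 (by nlinarith)
  filter_upwards [eventually_M_le_exp (show (0 : ℝ) < 2 / 100 by norm_num), eventually_ge_atTop 1] with n hn hn1
  exact ⟨M_pos n, M_mul_recordP_int hn1, M_mul_recordQ_int hn1, hn⟩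

end Summit.KontsevichZagierPeriods.Zeta5Search.RecordRay
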